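import Literature.Probability.LatticeModels.SRWHeatKernelLCLT
import Literature.Probability.LatticeModels.LatticeGreenHeatKernel
import Mathlib.Analysis.SpecialFunctions.Gamma.Basic
import Mathlib.MeasureTheory.Integral.IntegralEqImproper
import Mathlib.MeasureTheory.Group.Measure
import HarnessLib

/-!
# Asymptotics of the lattice Green function: `G(x) = a_d|x|^{2-d} + O(|x|^{-d})` (`d ≥ 3`)

Topic `Probability/LatticeModels`. The classical expansion of the Green function of simple random
walk on `ℤ^d`, `d ≥ 3` (Lawler–Limic 2010, Thm. 4.3.1; Uchiyama 1998; Lawler 1991, Thm. 1.5.4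
with `o(|x|^{-α})`, `α < d`): in the normalisation of `LatticeGreenFunction.lean`
(`latticeGreen = G/d`, `G(x) = Σₙ P(Sₙ = x)`),

* `latticeGreen_asymptotics` — **for `d ≥ 3` there is `K` with
  `|latticeGreen x - (Γ(d/2-1)/(2π^{d/2})) |x|^{2-d}| ≤ K |x|^{-d}` for all `x ≠ 0`**
  (`|x|` Euclidean), i.e. `G(x) = a_d|x|^{2-d} + O(|x|^{-d})` with `a_d = dΓ(d/2-1)/(2π^{d/2})`.

PROOF (all in this file and its two companions). By `LatticeGreenHeatKernel.lean`,
`latticeGreen x = ∫₀^∞ ∏ᵢ q_t(xᵢ) dt` with the one-dimensional continuous-time heat kernel `q_t`;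
the Gaussian counterpart `∫₀^∞ ∏ᵢ φ_t(xᵢ) dt = ∫₀^∞ (2πt)^{-d/2}e^{-|x|²/2t} dt` equals
`Γ(d/2-1)/(2π^{d/2}) |x|^{2-d}` exactly (`integral_prod_gaussHeatKernel`). The difference is
estimated through the telescoping identity `∏q - ∏φ = Σⱼ (∏_{i<j} q)(qⱼ - φⱼ)(∏_{i>j} φ)`
(`abs_prod_sub_prod_le`) and the one-dimensional inputs of `SRWHeatKernel1D.lean`,
`SRWHeatKernelLCLT.lean` with weight exponent `p = d`: for `t ≥ 1`,
`|q|, φ ≤ A₁t^{-1/2}(1 + xᵢ²/t)^{-d}` and `|q - φ| ≤ Bt^{-3/2}(1 + xᵢ²/t)^{-d}`, whence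
`|∏q - ∏φ| ≤ dBA₁^{d-1} t^{-(d+2)/2} (1 + |x|²/t)^{-d} ≤ dBA₁^{d-1}(t + |x|²)^{-(d+2)/2}`
(`∏ᵢ(1 + xᵢ²/t) ≥ 1 + |x|²/t`), which integrates over `t ≥ 1` to `≤ (2/d)·dBA₁^{d-1}|x|^{-d}`; for
`0 < t ≤ 1` both products are `O(|x|^{-d})` pointwise (`|q_t(m)| ≤ A(1+m²)^{-d}`,
`φ_t(m) ≤ C t^{-1/2}(1+m²/t)^{-d}`). No step uses more than `|x| ≥ 1`, so the constant is uniform in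
`x ≠ 0`.

## References

* G. F. Lawler, V. Limic, *Random Walk: A Modern Introduction*, CUP 2010, Thm. 4.3.1
  (`G(x) = C_d/|x|^{d-2} + O(|x|^{-d})`, `C_d = dΓ(d/2)/((d-2)π^{d/2}) = a_d`) [LawlerLimic2010].
* G. F. Lawler, *Intersections of Random Walks*, Birkhäuser 1991, Thm. 1.5.4 [Lawler1991].
* Y. Liu, G. Slade, Ann. Inst. H. Poincaré Probab. Statist. (2026), arXiv:2310.07640, §1.2.1 (1.8):
  the statement as used for the lace expansion [LiuSlade2026].
-/

noncomputable section

open MeasureTheory Set Filter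
open scoped Real Topology BigOperators

namespace Literature.Probability.LatticeModels

variable {d : ℕ}

/-! ### Telescoping a difference of products -/

/-- **Telescoping bound**: if `|fᵢ|, |gᵢ| ≤ aᵢ` and `|fᵢ - gᵢ| ≤ δᵢ` on `s`, then
`|∏_s f - ∏_s g| ≤ Σ_{j∈s} δⱼ ∏_{i∈s∖{j}} aᵢ`. [folklore] -/
theorem abs_prod_sub_prod_le {ι : Type*} [DecidableEq ι] (s : Finset ι) (f g a δ : ι → ℝ)
    (hf : ∀ i ∈ s, |f i| ≤ a i) (hg : ∀ i ∈ s, |g i| ≤ a i) (hδ : ∀ i ∈ s, |f i - g i| ≤ δ i) :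
    |∏ i ∈ s, f i - ∏ i ∈ s, g i| ≤ ∑ j ∈ s, δ j * ∏ i ∈ s.erase j, a i := by
  induction s using Finset.induction_on with
  | empty => simp
  | @insert k s hk ih =>
    have hf' : ∀ i ∈ s, |f i| ≤ a i := fun i hi => hf i (Finset.mem_insert_of_mem hi)
    have hg' : ∀ i ∈ s, |g i| ≤ a i := fun i hi => hg i (Finset.mem_insert_of_mem hi)
    have hδ' : ∀ i ∈ s, |f i - g i| ≤ δ i := fun i hi => hδ i (Finset.mem_insert_of_mem hi)
    have ih' := ih hf' hg' hδ'
    have ha0 : ∀ i ∈ s, 0 ≤ a i := fun i hi => (abs_nonneg _).trans (hf' i hi)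
    have hak : 0 ≤ a k := (abs_nonneg _).trans (hf k (Finset.mem_insert_self k s))
    have hPf : |∏ i ∈ s, f i| ≤ ∏ i ∈ s, a i := by
      rw [Finset.abs_prod]
      exact Finset.prod_le_prod (fun i _ => abs_nonneg _) hf'
    rw [Finset.prod_insert hk, Finset.prod_insert hk, Finset.sum_insert hk, Finset.erase_insert hk]
    -- the sum over `s` with `insert k s` erased at `j ≠ k`
    have hsum : ∑ j ∈ s, δ j * ∏ i ∈ (insert k s).erase j, a i =
        a k * ∑ j ∈ s, δ j * ∏ i ∈ s.erase j, a i := by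
      rw [Finset.mul_sum]
      refine Finset.sum_congr rfl fun j hj => ?_
      have hjk : j ≠ k := fun h => hk (h ▸ hj)
      rw [Finset.erase_insert_of_ne hjk.symm, Finset.prod_insert (fun h => hk (Finset.mem_of_mem_erase h))]
      ring
    rw [hsum]
    have hsplit : f k * ∏ i ∈ s, f i - g k * ∏ i ∈ s, g i =
        (f k - g k) * ∏ i ∈ s, f i + g k * (∏ i ∈ s, f i - ∏ i ∈ s, g i) := by ring
    rw [hsplit]
    have hS0 : 0 ≤ ∑ j ∈ s, δ j * ∏ i ∈ s.erase j, a i := (abs_nonneg _).trans ih'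
    calc |(f k - g k) * ∏ i ∈ s, f i + g k * (∏ i ∈ s, f i - ∏ i ∈ s, g i)|
        ≤ |(f k - g k) * ∏ i ∈ s, f i| + |g k * (∏ i ∈ s, f i - ∏ i ∈ s, g i)| := abs_add_le _ _
      _ = |f k - g k| * |∏ i ∈ s, f i| + |g k| * |∏ i ∈ s, f i - ∏ i ∈ s, g i| := by
          rw [abs_mul, abs_mul]
      _ ≤ δ k * ∏ i ∈ s, a i + a k * ∑ j ∈ s, δ j * ∏ i ∈ s.erase j, a i := by
          gcongr
          · exact (abs_nonneg _).trans (hδ k (Finset.mem_insert_self k s))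
          · exact hδ k (Finset.mem_insert_self k s)
          · exact hg k (Finset.mem_insert_self k s)

/-- `1 + Σᵢ aᵢ ≤ ∏ᵢ (1 + aᵢ)` for `aᵢ ≥ 0`. [folklore] -/
theorem one_add_sum_le_prod_one_add {ι : Type*} [DecidableEq ι] (s : Finset ι) (a : ι → ℝ)
    (ha : ∀ i ∈ s, 0 ≤ a i) : 1 + ∑ i ∈ s, a i ≤ ∏ i ∈ s, (1 + a i) := by
  induction s using Finset.induction_on with
  | empty => simp
  | @insert k s hk ih =>
    have ha' : ∀ i ∈ s, 0 ≤ a i := fun i hi => ha i (Finset.mem_insert_of_mem hi)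
    have h1 := ih ha'
    have hk0 : 0 ≤ a k := ha k (Finset.mem_insert_self k s)
    have hS : 0 ≤ ∑ i ∈ s, a i := Finset.sum_nonneg ha'
    rw [Finset.sum_insert hk, Finset.prod_insert hk]
    have hP : 1 ≤ ∏ i ∈ s, (1 + a i) := by linarith
    nlinarith [mul_nonneg hk0 (sub_nonneg.2 hP)]

/-! ### The Euclidean norm of a nonzero lattice point -/

/-- A nonzero point of `ℤ^d` has `Σᵢ xᵢ² ≥ 1`. [folklore] -/
theorem one_le_sum_sq_of_ne_zero {x : Site d} (hx : x ≠ 0) : (1 : ℝ) ≤ ∑ i, ((x i : ℤ) : ℝ) ^ 2 := by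
  obtain ⟨j, hj⟩ : ∃ j, x j ≠ 0 := by
    by_contra h
    push Not at h
    exact hx (funext h)
  have h1 : (1 : ℝ) ≤ ((x j : ℤ) : ℝ) ^ 2 := by
    have : (1 : ℤ) ≤ (x j) ^ 2 := by
      have := Int.one_le_abs hj
      nlinarith [abs_mul_abs_self (x j), sq_abs (x j)]
    exact_mod_cast this
  exact h1.trans (Finset.single_le_sum (f := fun i => ((x i : ℤ) : ℝ) ^ 2) (fun i _ => sq_nonneg _)
    (Finset.mem_univ j))

/-- Hence `|x| = √(Σᵢ xᵢ²) ≥ 1` for `x ≠ 0`. [folklore] -/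
theorem one_le_sqrt_sum_sq_of_ne_zero {x : Site d} (hx : x ≠ 0) :
    (1 : ℝ) ≤ Real.sqrt (∑ i, ((x i : ℤ) : ℝ) ^ 2) := by
  rw [show (1 : ℝ) = Real.sqrt 1 by simp]
  exact Real.sqrt_le_sqrt (one_le_sum_sq_of_ne_zero hx)

/-! ### The Gaussian product and its time integral -/

/-- The product of the one-dimensional Gaussian kernels is the `d`-dimensional one:
`∏ᵢ φ_t(xᵢ) = e^{-|x|²/(2t)} / (√(2πt))^d`. [folklore] -/
theorem prod_gaussHeatKernel (t : ℝ) (x : Site d) :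
    ∏ i, gaussHeatKernel t (x i) =
      Real.exp (-((∑ i, ((x i : ℤ) : ℝ) ^ 2) / (2 * t))) / Real.sqrt (2 * π * t) ^ d := by
  unfold gaussHeatKernel
  rw [Finset.prod_div_distrib, Finset.prod_const, Finset.card_univ, Fintype.card_fin, ← Real.exp_sum,
    Finset.sum_div, Finset.sum_neg_distrib]

/-- `∫₀^∞ t^{-β} e^{-α/t} dt = α^{1-β} Γ(β-1)` for `α > 0`, `β > 1` (substitute `t = 1/y`).
[folklore] -/
theorem integral_Ioi_rpow_neg_mul_exp_neg_div {α β : ℝ} (hα : 0 < α) (hβ : 1 < β) :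
    ∫ t in Ioi (0 : ℝ), t ^ (-β) * Real.exp (-(α / t)) = (1 / α) ^ (β - 1) * Real.Gamma (β - 1) := by
  have hsub := integral_comp_rpow_Ioi (fun y : ℝ => y ^ (β - 2) * Real.exp (-(α * y))) (p := -1) (by norm_num)
  have hpt : Set.EqOn
      (fun x : ℝ => (|(-1 : ℝ)| * x ^ ((-1 : ℝ) - 1)) • ((x ^ (-1 : ℝ)) ^ (β - 2) * Real.exp (-(α * x ^ (-1 : ℝ)))))
      (fun t => t ^ (-β) * Real.exp (-(α / t))) (Ioi 0) := by
    intro x hx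
    have hx0 : (0 : ℝ) < x := hx
    simp only [smul_eq_mul, abs_neg, abs_one, one_mul]
    rw [Real.rpow_neg_one, ← Real.rpow_neg_one x, ← Real.rpow_mul hx0.le, ← mul_assoc, ← Real.rpow_add hx0]
    congr 1
    · ring_nf
    · rw [Real.rpow_neg_one, div_eq_mul_inv]
  rw [← setIntegral_congr_fun measurableSet_Ioi hpt, hsub]
  have h := Real.integral_rpow_mul_exp_neg_mul_Ioi (a := β - 1) (r := α) (by linarith) hα
  rw [show β - 1 - 1 = β - 2 by ring] at h
  exact h

/-- **The Gaussian time integral**: for `d ≥ 3` and `x ≠ 0`, `t ↦ ∏ᵢ φ_t(xᵢ)` is integrable on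
`(0,∞)` and `∫₀^∞ ∏ᵢ φ_t(xᵢ) dt = Γ(d/2 - 1)/(2π^{d/2}) · |x|^{2-d}` — the origin of the amplitude
`a_d = dΓ(d/2-1)/(2π^{d/2})` (Lawler–Limic's `C_d = dΓ(d/2)/((d-2)π^{d/2})`, Thm. 4.3.1). [folklore] -/
theorem integral_prod_gaussHeatKernel (hd : 3 ≤ d) {x : Site d} (hx : x ≠ 0) :
    IntegrableOn (fun t : ℝ => ∏ i, gaussHeatKernel t (x i)) (Ioi 0) ∧
      ∫ t in Ioi (0 : ℝ), ∏ i, gaussHeatKernel t (x i) =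
        Real.Gamma ((d : ℝ) / 2 - 1) / (2 * π ^ ((d : ℝ) / 2)) *
          Real.sqrt (∑ i, ((x i : ℤ) : ℝ) ^ 2) ^ (2 - (d : ℝ)) := by
  set S : ℝ := ∑ i, ((x i : ℤ) : ℝ) ^ 2 with hS
  have hS1 : 1 ≤ S := one_le_sum_sq_of_ne_zero hx
  have hS0 : 0 < S := by linarith
  set r : ℝ := Real.sqrt S with hr
  have hr0 : 0 < r := Real.sqrt_pos.2 hS0
  have hrS : r ^ 2 = S := Real.sq_sqrt hS0.le
  have hd3 : (3 : ℝ) ≤ d := by exact_mod_cast hd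
  set β : ℝ := (d : ℝ) / 2 with hβ
  have hβ1 : 1 < β := by rw [hβ]; linarith
  set α : ℝ := S / 2 with hα
  have hα0 : 0 < α := by positivity
  have hπ := Real.pi_pos
  -- pointwise form on `(0, ∞)`
  have hpt : Set.EqOn (fun t : ℝ => ∏ i, gaussHeatKernel t (x i))
      (fun t => (2 * π) ^ (-β) * (t ^ (-β) * Real.exp (-(α / t)))) (Ioi 0) := by
    intro t ht
    have ht0 : (0 : ℝ) < t := ht
    simp only
    rw [prod_gaussHeatKernel, ← hS, Real.sqrt_eq_rpow, ← Real.rpow_natCast, ← Real.rpow_mul (by positivity),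
      Real.mul_rpow (by positivity) ht0.le, show (1 / 2 : ℝ) * (d : ℝ) = β by rw [hβ]; ring,
      Real.rpow_neg (by positivity), Real.rpow_neg ht0.le, hα]
    field_simp
  -- the value
  have hval : ∫ t in Ioi (0 : ℝ), ∏ i, gaussHeatKernel t (x i) =
      Real.Gamma ((d : ℝ) / 2 - 1) / (2 * π ^ ((d : ℝ) / 2)) * r ^ (2 - (d : ℝ)) := by
    rw [setIntegral_congr_fun measurableSet_Ioi hpt, integral_const_mul,
      integral_Ioi_rpow_neg_mul_exp_neg_div hα0 hβ1, show (d : ℝ) / 2 - 1 = β - 1 by rw [hβ]]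
    -- constants: `(2π)^{-β} (2/S)^{β-1} = r^{2-d}/(2π^β)`
    have h1 : (1 / α) ^ (β - 1) = 2 ^ (β - 1) * r ^ (2 - (d : ℝ)) := by
      rw [hα, show 1 / (S / 2) = 2 * S⁻¹ by field_simp, Real.mul_rpow (by norm_num) (by positivity),
        ← hrS, ← Real.rpow_natCast, ← Real.rpow_neg hr0.le, ← Real.rpow_mul hr0.le]
      congr 1
      congr 1
      rw [hβ]; push_cast; ring
    have h2 : (2 * π) ^ (-β) * 2 ^ (β - 1) = 1 / (2 * π ^ β) := by
      rw [Real.mul_rpow (by norm_num) hπ.le, Real.rpow_neg (by norm_num), Real.rpow_sub (by norm_num),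
        Real.rpow_one, Real.rpow_neg hπ.le]
      field_simp
    calc (2 * π) ^ (-β) * ((1 / α) ^ (β - 1) * Real.Gamma (β - 1))
        = ((2 * π) ^ (-β) * 2 ^ (β - 1)) * Real.Gamma (β - 1) * r ^ (2 - (d : ℝ)) := by rw [h1]; ring
      _ = Real.Gamma (β - 1) / (2 * π ^ β) * r ^ (2 - (d : ℝ)) := by rw [h2]; ring
  refine ⟨?_, hval⟩
  -- integrability: the integral is a positive number
  by_contra h
  have h0 := integral_undef h
  rw [hval] at h0
  have hpos : 0 < Real.Gamma ((d : ℝ) / 2 - 1) / (2 * π ^ ((d : ℝ) / 2)) * r ^ (2 - (d : ℝ)) := by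
    have hG : 0 < Real.Gamma ((d : ℝ) / 2 - 1) := Real.Gamma_pos_of_pos (by linarith)
    positivity
  linarith

/-! ### A translated power integral -/

/-- `∫_{t > a} (t + c)^s dt = -(a+c)^{s+1}/(s+1)` for `s < -1`, `a + c > 0`, with integrability
(translation invariance of Lebesgue measure and `integral_Ioi_rpow_of_lt`). [folklore] -/
theorem integral_Ioi_add_rpow {a c s : ℝ} (hac : 0 < a + c) (hs : s < -1) :
    IntegrableOn (fun t : ℝ => (t + c) ^ s) (Ioi a) ∧
      ∫ t in Ioi a, (t + c) ^ s = -(a + c) ^ (s + 1) / (s + 1) := by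
  have hmp : MeasurePreserving (fun t : ℝ => t + c) volume volume := measurePreserving_add_right volume c
  have hme : MeasurableEmbedding (fun t : ℝ => t + c) := measurableEmbedding_addRight c
  have hpre : (fun t : ℝ => t + c) ⁻¹' (Ioi (a + c)) = Ioi a := by
    ext t; simp
  refine ⟨?_, ?_⟩
  · have h := (hmp.integrableOn_comp_preimage hme (f := fun u : ℝ => u ^ s) (s := Ioi (a + c))).2
      (integrableOn_Ioi_rpow_of_lt hs hac)
    rw [hpre] at h
    exact h
  · have h := hmp.setIntegral_preimage_emb hme (fun u : ℝ => u ^ s) (Ioi (a + c))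
    rw [hpre] at h
    rw [h, integral_Ioi_rpow_of_lt hs hac]

/-! ### Small times: both products are `O(|x|^{-d})` pointwise -/

/-- For `0 < t ≤ 1`: `|∏ᵢ q_t(xᵢ)| ≤ A^d (1 + |x|²)^{-d}`, from the one-dimensional decay bound
with weight exponent `d` (at `t ≤ 1` it reads `|q_t(m)| ≤ A(1 + m²)^{-d}`) and
`∏ᵢ(1 + xᵢ²) ≥ 1 + |x|²`. [folklore] -/
theorem abs_prod_srwHeatKernel_le_small {A : ℝ} (hA0 : 0 < A)
    (hA : ∀ t : ℝ, 0 < t → ∀ m : ℤ,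
      |srwHeatKernel t m| ≤ A * (max 1 t) ^ (-(1 / 2 : ℝ)) * ((1 + (m : ℝ) ^ 2 / max 1 t) ^ d)⁻¹)
    {t : ℝ} (ht0 : 0 < t) (ht1 : t ≤ 1) (x : Site d) :
    |∏ i, srwHeatKernel t (x i)| ≤ A ^ d * ((1 + ∑ i, ((x i : ℤ) : ℝ) ^ 2) ^ d)⁻¹ := by
  have hmax : max 1 t = 1 := max_eq_left ht1
  have hq : ∀ i, |srwHeatKernel t (x i)| ≤ A * ((1 + ((x i : ℤ) : ℝ) ^ 2) ^ d)⁻¹ := by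
    intro i
    have h := hA t ht0 (x i)
    rw [hmax, Real.one_rpow, mul_one, div_one] at h
    exact h
  rw [Finset.abs_prod]
  calc ∏ i, |srwHeatKernel t (x i)| ≤ ∏ i, A * ((1 + ((x i : ℤ) : ℝ) ^ 2) ^ d)⁻¹ :=
        Finset.prod_le_prod (fun i _ => abs_nonneg _) fun i _ => hq i
    _ = A ^ d * ((∏ i, (1 + ((x i : ℤ) : ℝ) ^ 2)) ^ d)⁻¹ := by
        rw [Finset.prod_mul_distrib, Finset.prod_const, Finset.card_univ, Fintype.card_fin,
          Finset.prod_inv_distrib, Finset.prod_pow]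
    _ ≤ A ^ d * ((1 + ∑ i, ((x i : ℤ) : ℝ) ^ 2) ^ d)⁻¹ := by
        have h1 := one_add_sum_le_prod_one_add Finset.univ (fun i => ((x i : ℤ) : ℝ) ^ 2)
          (fun i _ => sq_nonneg _)
        have h0 : 0 < (1 + ∑ i, ((x i : ℤ) : ℝ) ^ 2) ^ d := by positivity
        gcongr

/-- For `0 < t ≤ 1` and `x ≠ 0`: `∏ᵢ φ_t(xᵢ) ≤ C^d |x|^{-d}`, from
`φ_t(m) ≤ Ct^{-1/2}(1 + m²/t)^{-d}`: the product is at most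
`C^d t^{-d/2}(1 + |x|²/t)^{-d} ≤ C^d t^{d/2}|x|^{-2d}`. [folklore] -/
theorem prod_gaussHeatKernel_le_small {C : ℝ} (hC0 : 0 < C)
    (hC : ∀ t : ℝ, 0 < t → ∀ m : ℝ, gaussHeatKernel t m ≤ C * t ^ (-(1 / 2 : ℝ)) * ((1 + m ^ 2 / t) ^ d)⁻¹)
    {t : ℝ} (ht0 : 0 < t) (ht1 : t ≤ 1) {x : Site d} (hx : x ≠ 0) :
    ∏ i, gaussHeatKernel t (x i) ≤ C ^ d * Real.sqrt (∑ i, ((x i : ℤ) : ℝ) ^ 2) ^ (-(d : ℝ)) := by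
  set S : ℝ := ∑ i, ((x i : ℤ) : ℝ) ^ 2 with hS
  have hS1 : 1 ≤ S := one_le_sum_sq_of_ne_zero hx
  have hS0 : 0 < S := by linarith
  set r : ℝ := Real.sqrt S with hr
  have hr1 : 1 ≤ r := one_le_sqrt_sum_sq_of_ne_zero hx
  have hr0 : 0 < r := by linarith
  have hrS : r ^ 2 = S := Real.sq_sqrt hS0.le
  -- the product of the weights
  have hprod : ∏ i, gaussHeatKernel t (x i) ≤
      C ^ d * (t ^ (-(1 / 2 : ℝ))) ^ d * ((∏ i, (1 + ((x i : ℤ) : ℝ) ^ 2 / t)) ^ d)⁻¹ := by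
    calc ∏ i, gaussHeatKernel t (x i)
        ≤ ∏ i, C * t ^ (-(1 / 2 : ℝ)) * ((1 + ((x i : ℤ) : ℝ) ^ 2 / t) ^ d)⁻¹ :=
          Finset.prod_le_prod (fun i _ => gaussHeatKernel_nonneg _ _) fun i _ => hC t ht0 _
      _ = C ^ d * (t ^ (-(1 / 2 : ℝ))) ^ d * ((∏ i, (1 + ((x i : ℤ) : ℝ) ^ 2 / t)) ^ d)⁻¹ := by
          rw [Finset.prod_mul_distrib, Finset.prod_const, Finset.card_univ, Fintype.card_fin, mul_pow,
            Finset.prod_inv_distrib, Finset.prod_pow]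
  -- `∏(1 + xᵢ²/t) ≥ S/t`
  have hw : ((∏ i, (1 + ((x i : ℤ) : ℝ) ^ 2 / t)) ^ d)⁻¹ ≤ ((S / t) ^ d)⁻¹ := by
    have h1 := one_add_sum_le_prod_one_add Finset.univ (fun i => ((x i : ℤ) : ℝ) ^ 2 / t)
      (fun i _ => by positivity)
    have h2 : S / t ≤ ∏ i, (1 + ((x i : ℤ) : ℝ) ^ 2 / t) := by
      rw [hS, Finset.sum_div]; linarith
    have h3 : 0 < (S / t) ^ d := by positivity
    exact inv_anti₀ h3 (pow_le_pow_left₀ (by positivity) h2 d)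
  -- `(t^{-1/2})^d (S/t)^{-d} = t^{d/2} S^{-d} ≤ r^{-d}`
  have hpow : (t ^ (-(1 / 2 : ℝ))) ^ d * ((S / t) ^ d)⁻¹ = t ^ ((d : ℝ) / 2) * (S ^ d)⁻¹ := by
    rw [← Real.rpow_mul_natCast ht0.le, div_pow, inv_div, ← Real.rpow_natCast t d]
    have e : t ^ ((d : ℝ) / 2) = t ^ (-(1 / 2 : ℝ) * d) * t ^ (d : ℝ) := by
      rw [← Real.rpow_add ht0]; congr 1; ring
    rw [e]; field_simp
  have ht2 : t ^ ((d : ℝ) / 2) ≤ 1 := Real.rpow_le_one ht0.le ht1 (by positivity)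
  have hSd : (S ^ d)⁻¹ ≤ r ^ (-(d : ℝ)) := by
    rw [Real.rpow_neg hr0.le, Real.rpow_natCast]
    refine inv_anti₀ (by positivity) ?_
    rw [← hrS, ← pow_mul]
    exact pow_le_pow_right₀ hr1 (by omega)
  calc ∏ i, gaussHeatKernel t (x i)
      ≤ C ^ d * (t ^ (-(1 / 2 : ℝ))) ^ d * ((∏ i, (1 + ((x i : ℤ) : ℝ) ^ 2 / t)) ^ d)⁻¹ := hprod
    _ ≤ C ^ d * (t ^ (-(1 / 2 : ℝ))) ^ d * ((S / t) ^ d)⁻¹ := by gcongr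
    _ = C ^ d * (t ^ ((d : ℝ) / 2) * (S ^ d)⁻¹) := by rw [mul_assoc, hpow]
    _ ≤ C ^ d * (1 * r ^ (-(d : ℝ))) := by gcongr
    _ = C ^ d * r ^ (-(d : ℝ)) := by rw [one_mul]

/-! ### Large times: the telescoped local limit theorem -/

/-- For `t ≥ 1` (`d ≥ 2`): if `|q_t(m)|, φ_t(m) ≤ A₁t^{-1/2}(1 + m²/t)^{-d}` and
`|q_t(m) - φ_t(m)| ≤ Bt^{-3/2}(1 + m²/t)^{-d}` for all `m`, then
`|∏ᵢ q_t(xᵢ) - ∏ᵢ φ_t(xᵢ)| ≤ d B A₁^{d-1} (t + |x|²)^{-(d+2)/2}` (telescoping,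
`∏ᵢ(1 + xᵢ²/t) ≥ 1 + |x|²/t`, `(1 + |x|²/t)^{-d} ≤ (1 + |x|²/t)^{-(d+2)/2}`). [folklore] -/
theorem abs_prod_sub_prod_le_large (hd : 2 ≤ d) {A₁ B t : ℝ} (hA : 0 ≤ A₁) (hB : 0 ≤ B) (ht : 1 ≤ t)
    (x : Site d)
    (hq : ∀ m : ℤ, |srwHeatKernel t m| ≤ A₁ * t ^ (-(1 / 2 : ℝ)) * ((1 + (m : ℝ) ^ 2 / t) ^ d)⁻¹)
    (hφ : ∀ m : ℤ, gaussHeatKernel t m ≤ A₁ * t ^ (-(1 / 2 : ℝ)) * ((1 + (m : ℝ) ^ 2 / t) ^ d)⁻¹)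
    (hδ : ∀ m : ℤ, |srwHeatKernel t m - gaussHeatKernel t m| ≤
      B * t ^ (-(3 / 2 : ℝ)) * ((1 + (m : ℝ) ^ 2 / t) ^ d)⁻¹) :
    |∏ i, srwHeatKernel t (x i) - ∏ i, gaussHeatKernel t (x i)| ≤
      d * B * A₁ ^ (d - 1) * (t + ∑ i, ((x i : ℤ) : ℝ) ^ 2) ^ (-(((d : ℝ) + 2) / 2)) := by
  classical
  have ht0 : 0 < t := by linarith
  set S : ℝ := ∑ i, ((x i : ℤ) : ℝ) ^ 2 with hS
  have hS0 : 0 ≤ S := by positivity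
  set w : Fin d → ℝ := fun i => ((1 + ((x i : ℤ) : ℝ) ^ 2 / t) ^ d)⁻¹ with hw
  have hw0 : ∀ i, 0 ≤ w i := fun i => by positivity
  set a : Fin d → ℝ := fun i => A₁ * t ^ (-(1 / 2 : ℝ)) * w i with ha
  set δ : Fin d → ℝ := fun i => B * t ^ (-(3 / 2 : ℝ)) * w i with hδ'
  have htel := abs_prod_sub_prod_le Finset.univ (fun i => srwHeatKernel t (x i))
    (fun i => gaussHeatKernel t (x i)) a δ (fun i _ => hq (x i))
    (fun i _ => by rw [abs_of_nonneg (gaussHeatKernel_nonneg _ _)]; exact hφ (x i)) (fun i _ => hδ (x i))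
  -- each summand equals `B (A₁t^{-1/2})^{d-1} t^{-3/2} ∏ w`
  have hterm : ∀ j ∈ (Finset.univ : Finset (Fin d)), δ j * ∏ i ∈ Finset.univ.erase j, a i =
      B * (A₁ * t ^ (-(1 / 2 : ℝ))) ^ (d - 1) * t ^ (-(3 / 2 : ℝ)) * ∏ i, w i := by
    intro j _
    rw [ha, Finset.prod_mul_distrib, Finset.prod_const, Finset.card_erase_of_mem (Finset.mem_univ j),
      Finset.card_univ, Fintype.card_fin, ← Finset.mul_prod_erase Finset.univ w (Finset.mem_univ j), hδ']
    ring
  rw [Finset.sum_congr rfl hterm, Finset.sum_const, Finset.card_univ, Fintype.card_fin, nsmul_eq_mul] at htel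
  -- `∏ w ≤ ((1 + S/t)^d)⁻¹ ≤ (1 + S/t)^{-(d+2)/2}`
  have hv0 : 0 ≤ S / t := by positivity
  have hprodw : ∏ i, w i ≤ (1 + S / t) ^ (-(((d : ℝ) + 2) / 2)) := by
    have e1 : ∏ i, w i = ((∏ i, (1 + ((x i : ℤ) : ℝ) ^ 2 / t)) ^ d)⁻¹ := by
      rw [hw, Finset.prod_inv_distrib, Finset.prod_pow]
    rw [e1]
    have h1 := one_add_sum_le_prod_one_add Finset.univ (fun i => ((x i : ℤ) : ℝ) ^ 2 / t)
      (fun i _ => by positivity)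
    rw [← Finset.sum_div, ← hS] at h1
    calc ((∏ i, (1 + ((x i : ℤ) : ℝ) ^ 2 / t)) ^ d)⁻¹ ≤ ((1 + S / t) ^ d)⁻¹ :=
          inv_anti₀ (by positivity) (pow_le_pow_left₀ (by positivity) h1 d)
      _ ≤ ((1 + S / t) ^ (((d : ℝ) + 2) / 2))⁻¹ := by
          refine inv_anti₀ (by positivity) ?_
          rw [← Real.rpow_natCast]
          refine Real.rpow_le_rpow_of_exponent_le (by linarith) ?_
          have : (2 : ℝ) ≤ d := by exact_mod_cast hd
          linarith
      _ = (1 + S / t) ^ (-(((d : ℝ) + 2) / 2)) := by rw [Real.rpow_neg (by positivity)]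
  -- powers of `t`
  have hd1 : ((d - 1 : ℕ) : ℝ) = (d : ℝ) - 1 := by
    rw [Nat.cast_sub (by omega)]; simp
  have htpow : (A₁ * t ^ (-(1 / 2 : ℝ))) ^ (d - 1) * t ^ (-(3 / 2 : ℝ)) =
      A₁ ^ (d - 1) * t ^ (-(((d : ℝ) + 2) / 2)) := by
    rw [mul_pow, ← Real.rpow_mul_natCast ht0.le, hd1, mul_assoc, ← Real.rpow_add ht0]
    congr 2; ring
  have hcomb : t ^ (-(((d : ℝ) + 2) / 2)) * (1 + S / t) ^ (-(((d : ℝ) + 2) / 2)) =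
      (t + S) ^ (-(((d : ℝ) + 2) / 2)) := by
    rw [← Real.mul_rpow ht0.le (by positivity)]
    congr 1; field_simp
  have hfin : 0 ≤ (d : ℝ) * (B * (A₁ * t ^ (-(1 / 2 : ℝ))) ^ (d - 1) * t ^ (-(3 / 2 : ℝ))) := by positivity
  calc |∏ i, srwHeatKernel t (x i) - ∏ i, gaussHeatKernel t (x i)|
      ≤ (d : ℝ) * (B * (A₁ * t ^ (-(1 / 2 : ℝ))) ^ (d - 1) * t ^ (-(3 / 2 : ℝ)) * ∏ i, w i) := htel
    _ = (d : ℝ) * (B * (A₁ * t ^ (-(1 / 2 : ℝ))) ^ (d - 1) * t ^ (-(3 / 2 : ℝ))) * ∏ i, w i := by ring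
    _ ≤ (d : ℝ) * (B * (A₁ * t ^ (-(1 / 2 : ℝ))) ^ (d - 1) * t ^ (-(3 / 2 : ℝ))) *
          (1 + S / t) ^ (-(((d : ℝ) + 2) / 2)) := mul_le_mul_of_nonneg_left hprodw hfin
    _ = d * B * A₁ ^ (d - 1) * (t ^ (-(((d : ℝ) + 2) / 2)) * (1 + S / t) ^ (-(((d : ℝ) + 2) / 2))) := by
        rw [mul_assoc B, htpow]; ring
    _ = d * B * A₁ ^ (d - 1) * (t + S) ^ (-(((d : ℝ) + 2) / 2)) := by rw [hcomb]

/-! ### The main theorem -/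

/-- **Asymptotics of the lattice Green function** (Lawler–Limic 2010, Thm. 4.3.1, in the
normalisation `latticeGreen = G/d` of `LatticeGreenFunction.lean`): for `d ≥ 3` there is a constant
`K` such that for every `x ∈ ℤ^d ∖ {0}`,
`|latticeGreen x - Γ(d/2 - 1)/(2π^{d/2}) · |x|^{2-d}| ≤ K |x|^{-d}`, `|x| = (Σᵢxᵢ²)^{1/2}`;
equivalently `G(x) = a_d|x|^{2-d} + O(|x|^{-d})` with `a_d = dΓ(d/2 - 1)/(2π^{d/2})`. Proved from the
heat-kernel representation, the exact Gaussian time integral, the telescoped Gaussian-weighted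
local limit theorem for `t ≥ 1` and the pointwise small-time bounds.
[cite: LawlerLimic2010, Theorem 4.3.1] -/
theorem latticeGreen_asymptotics (hd : 3 ≤ d) : ∃ K : ℝ, ∀ x : Site d, x ≠ 0 →
    |latticeGreen x - Real.Gamma ((d : ℝ) / 2 - 1) / (2 * π ^ ((d : ℝ) / 2)) *
        Real.sqrt (∑ i, ((x i : ℤ) : ℝ) ^ 2) ^ (2 - (d : ℝ))| ≤
      K * Real.sqrt (∑ i, ((x i : ℤ) : ℝ) ^ 2) ^ (-(d : ℝ)) := by
  obtain ⟨A, hA0, hA⟩ := srwHeatKernel_decay d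
  obtain ⟨B, hB0, hB⟩ := srwHeatKernel_lclt d
  set C : ℝ := 2 ^ d * d.factorial * Real.exp (1 / 2) with hC
  have hC0 : 0 < C := by positivity
  have hCw : ∀ t : ℝ, 0 < t → ∀ m : ℝ, gaussHeatKernel t m ≤ C * t ^ (-(1 / 2 : ℝ)) * ((1 + m ^ 2 / t) ^ d)⁻¹ :=
    fun t ht m => gaussHeatKernel_le_weight d ht m
  set A₁ : ℝ := max A C with hA₁
  have hA₁0 : 0 ≤ A₁ := le_max_of_le_left hA0.le
  have hd0 : (0 : ℝ) < d := by exact_mod_cast (show 0 < d by omega)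
  set K : ℝ := A ^ d + C ^ d + d * B * A₁ ^ (d - 1) * (2 / d) with hK
  refine ⟨K, fun x hx => ?_⟩
  set S : ℝ := ∑ i, ((x i : ℤ) : ℝ) ^ 2 with hS
  have hS1 : 1 ≤ S := one_le_sum_sq_of_ne_zero hx
  have hS0 : 0 < S := by linarith
  set r : ℝ := Real.sqrt S with hr
  have hr1 : 1 ≤ r := one_le_sqrt_sum_sq_of_ne_zero hx
  have hr0 : 0 < r := by linarith
  have hrS : r ^ 2 = S := Real.sq_sqrt hS0.le
  have hrd : 0 < r ^ (-(d : ℝ)) := Real.rpow_pos_of_pos hr0 _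
  -- the two representations
  obtain ⟨hPint, hPval⟩ := latticeGreen_eq_integral_prod_srwHeatKernel hd x
  obtain ⟨hQint, hQval⟩ := integral_prod_gaussHeatKernel hd hx
  rw [hPval, ← hQval, ← integral_sub hPint hQint]
  set h : ℝ → ℝ := fun t => ∏ i, srwHeatKernel t (x i) - ∏ i, gaussHeatKernel t (x i) with hh
  have hint : IntegrableOn h (Ioi 0) := hPint.sub hQint
  -- split at `t = 1`
  have hsplit : ∫ t in Ioi (0 : ℝ), h t = (∫ t in Ioc (0 : ℝ) 1, h t) + ∫ t in Ioi (1 : ℝ), h t := by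
    rw [← setIntegral_union Set.Ioc_disjoint_Ioi_same measurableSet_Ioi
      (hint.mono_set Set.Ioc_subset_Ioi_self) (hint.mono_set (Set.Ioi_subset_Ioi zero_le_one)),
      Set.Ioc_union_Ioi_eq_Ioi zero_le_one]
  -- small times
  have hsmall : ‖∫ t in Ioc (0 : ℝ) 1, h t‖ ≤ (A ^ d + C ^ d) * r ^ (-(d : ℝ)) := by
    have hb : ∀ t ∈ Ioc (0 : ℝ) 1, ‖h t‖ ≤ (A ^ d + C ^ d) * r ^ (-(d : ℝ)) := by
      intro t ht
      have h1 := abs_prod_srwHeatKernel_le_small hA0 hA ht.1 ht.2 x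
      have h2 := prod_gaussHeatKernel_le_small hC0 hCw ht.1 ht.2 hx
      have h3 : ((1 + S) ^ d)⁻¹ ≤ r ^ (-(d : ℝ)) := by
        rw [Real.rpow_neg hr0.le, Real.rpow_natCast]
        refine inv_anti₀ (by positivity) (pow_le_pow_left₀ hr0.le ?_ d)
        nlinarith
      have h4 : 0 ≤ ∏ i, gaussHeatKernel t (x i) := Finset.prod_nonneg fun i _ => gaussHeatKernel_nonneg _ _
      rw [Real.norm_eq_abs, hh]
      calc |∏ i, srwHeatKernel t (x i) - ∏ i, gaussHeatKernel t (x i)|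
          ≤ |∏ i, srwHeatKernel t (x i)| + |∏ i, gaussHeatKernel t (x i)| := abs_sub _ _
        _ ≤ A ^ d * ((1 + S) ^ d)⁻¹ + C ^ d * r ^ (-(d : ℝ)) := by
            rw [abs_of_nonneg h4]; exact add_le_add h1 h2
        _ ≤ A ^ d * r ^ (-(d : ℝ)) + C ^ d * r ^ (-(d : ℝ)) := by gcongr
        _ = (A ^ d + C ^ d) * r ^ (-(d : ℝ)) := by ring
    have h := norm_setIntegral_le_of_norm_le_const (show volume (Ioc (0 : ℝ) 1) < ⊤ from measure_Ioc_lt_top) hb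
    rwa [Real.volume_real_Ioc_of_le zero_le_one, sub_zero, mul_one] at h
  -- large times
  have hlarge : ‖∫ t in Ioi (1 : ℝ), h t‖ ≤ d * B * A₁ ^ (d - 1) * (2 / d) * r ^ (-(d : ℝ)) := by
    have hs : -(((d : ℝ) + 2) / 2) < -1 := by
      have : (3 : ℝ) ≤ d := by exact_mod_cast hd
      linarith
    obtain ⟨hgi, hgv⟩ := integral_Ioi_add_rpow (show (0 : ℝ) < 1 + S by linarith) hs
    set c : ℝ := d * B * A₁ ^ (d - 1) with hc
    have hc0 : 0 ≤ c := by positivity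
    have hbound : ∀ᵐ t ∂(volume.restrict (Ioi (1 : ℝ))), ‖h t‖ ≤ c * (t + S) ^ (-(((d : ℝ) + 2) / 2)) := by
      filter_upwards [ae_restrict_mem measurableSet_Ioi] with t ht
      have ht1 : 1 ≤ t := le_of_lt ht
      have ht0 : 0 < t := by linarith
      have htpos : 0 < t ^ (-(1 / 2 : ℝ)) := Real.rpow_pos_of_pos ht0 _
      rw [Real.norm_eq_abs, hh]
      refine abs_prod_sub_prod_le_large (by omega) hA₁0 hB0.le ht1 x (fun m => ?_) (fun m => ?_)
        (fun m => hB t ht1 m)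
      · have h1 := hA t ht0 m
        rw [max_eq_right ht1] at h1
        refine h1.trans ?_
        gcongr
        exact le_max_left _ _
      · refine (hCw t ht0 m).trans ?_
        gcongr
        exact le_max_right _ _
    calc ‖∫ t in Ioi (1 : ℝ), h t‖ ≤ ∫ t in Ioi (1 : ℝ), c * (t + S) ^ (-(((d : ℝ) + 2) / 2)) :=
          norm_integral_le_of_norm_le (hgi.const_mul c) hbound
      _ = c * (-(1 + S) ^ (-(((d : ℝ) + 2) / 2) + 1) / (-(((d : ℝ) + 2) / 2) + 1)) := by
          rw [integral_const_mul, hgv]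
      _ = c * (2 / d) * (1 + S) ^ (-((d : ℝ) / 2)) := by
          rw [show -(((d : ℝ) + 2) / 2) + 1 = -((d : ℝ) / 2) by ring]
          field_simp
      _ ≤ c * (2 / d) * r ^ (-(d : ℝ)) := by
          refine mul_le_mul_of_nonneg_left ?_ (by positivity)
          calc (1 + S) ^ (-((d : ℝ) / 2)) ≤ S ^ (-((d : ℝ) / 2)) :=
                Real.rpow_le_rpow_of_nonpos hS0 (by linarith) (by linarith)
            _ = r ^ (-(d : ℝ)) := by
                rw [← hrS, ← Real.rpow_natCast r 2, ← Real.rpow_mul hr0.le]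
                congr 1; push_cast; ring
  -- conclusion
  rw [hsplit, ← Real.norm_eq_abs]
  calc ‖(∫ t in Ioc (0 : ℝ) 1, h t) + ∫ t in Ioi (1 : ℝ), h t‖
      ≤ ‖∫ t in Ioc (0 : ℝ) 1, h t‖ + ‖∫ t in Ioi (1 : ℝ), h t‖ := norm_add_le _ _
    _ ≤ (A ^ d + C ^ d) * r ^ (-(d : ℝ)) + d * B * A₁ ^ (d - 1) * (2 / d) * r ^ (-(d : ℝ)) :=
        add_le_add hsmall hlarge
    _ = K * r ^ (-(d : ℝ)) := by rw [hK]; ring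

end Literature.Probability.LatticeModels
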